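import Summits.HodgeConjecture.HodgeConjecture.Theorems.F0P3cStCharTSVandermonde   -- ★ p848076 «VDM»: `eq_zero_of_sum_mul_pow_eq_zero`
import Mathlib.LinearAlgebra.LinearIndependent.Lemmas
import Mathlib.RingTheory.IntegralDomain                                          -- Mathlib ★ `linearIndependent_monoidHom` (Dedekind–Artin)
import HarnessLib

/-!
# F0 · P3c · line LH6 «StCharTS» — brick «ARTIN-S» of organ (S-i): DISTINCT CHARACTERS OF A TORUS ARE LINEARLY INDEPENDENT ON A DOMINANT RAY
# `{u · aᵐ : u ∈ T₀, m ≥ m₀}` (Artin on the compact part `T₀` + Vandermonde in the ray variable)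

Cell `pub/hodgecm-mathlib`, crux H413 = `stmt-HodgeConjecture-24833` (lane `--supports … --as helper`), route HCCMUnconditional; seat LH6-p02 (g0), organ (S-i)
`stub_StNoncuspidalMember` of the LH6 pay-down skeleton (v2 3bd6ede806aaa044 :297).  THEOREMS ONLY, sorry-free, generic (Mathlib + ★ «VDM»).
HONEST LABEL: HC_CM is proved only modulo the printed citations (2 remaining named inputs hLiu418 24832, h413 24833) until rung 0 closes; this is the «linear
independence of characters of `M`» step of [Rogawski1990, proof of L. 12.7.3 p. 195] in the form the shell road needs: the shell identities (★ R2d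
`Representation.smoothTrace_indicator_shell_eq`) are available only for STRICTLY DOMINANT torus elements `b = u·aᵐ` (`u` in the compact part `T₀ = T ∩ K₀`, `a` the
ray generator, `m ≥ m₀`), not on all of `T`; a relation `Σ_i c_i θ_i(b) = 0` on that ray set between characters `θ_i` that are pairwise distinct ON `⟨T₀, a⟩` already
forces `c = 0` — Artin's independence of the distinct restrictions `θ_i|T₀` (Mathlib ★ `linearIndependent_monoidHom`) isolates, for each restriction class and each
`m`, the sum `Σ_{θ_i|T₀ = ψ} c_i θ_i(a)^m = 0`, and inside a class the `θ_i(a)` are distinct and non-zero, so ★ «VDM» p848076 concludes.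

* `eq_zero_of_sum_mul_char_eq_zero_on_ray` — the statement above (no definition is introduced).

## References
* [Rogawski1990] J. D. Rogawski, Ann. of Math. Stud. 123 (1990): §12.7 proof of Lemma 12.7.2 p. 193 («Given finitely many pairs `c_j, z_j` …»), proof of Lemma 12.7.3
  p. 195 («linear independence of characters»).
* [Lang2002] S. Lang, *Algebra*, 3rd ed. (2002), VI §4 Thm. 4.1 (Artin: independence of characters).
-/

set_option autoImplicit false
-- the mandated namespace has the single-problem summit's repeated segment (`HodgeConjecture.HodgeConjecture`)
set_option linter.dupNamespace false

noncomputable section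

open scoped BigOperators

namespace Summit.HodgeConjecture.HodgeConjecture.Cruxes.H413.F0P3cStCharTSArtinRay

variable {T : Type*} [Group T] {ι : Type*} [Fintype ι]

/-- **«ARTIN-S»: distinct characters are linearly independent on a dominant ray set.**  Let `T₀ ≤ T`, `a ∈ T`, and `θ_i : T →* ℂˣ` (`i` in a finite index type)
be characters that are PAIRWISE DISTINCT ON `⟨T₀, a⟩` (equal restrictions to `T₀` and equal values at `a` force `i = j`).  If `Σ_i c_i θ_i(u·aᵐ) = 0` for every
`u ∈ T₀` and every `m ≥ m₀`, then `c = 0`. [cite: Rogawski1990, §12.7 proof of Lemma 12.7.3 p. 195; proof of Lemma 12.7.2 p. 193] [cite: Lang2002, VI §4 Thm. 4.1] -/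
theorem eq_zero_of_sum_mul_char_eq_zero_on_ray (T₀ : Subgroup T) (a : T) (θ : ι → (T →* ℂˣ))
    (hθ : ∀ i j, (∀ u ∈ T₀, θ i u = θ j u) → θ i a = θ j a → i = j)
    (c : ι → ℂ) (m₀ : ℕ) (h : ∀ u ∈ T₀, ∀ m : ℕ, m₀ ≤ m → ∑ i, c i * ((θ i (u * a ^ m) : ℂˣ) : ℂ) = 0) : c = 0 := by
  classical
  -- restriction classes (the restrictions `θ_i|T₀` read in `ℂ`, the shape of Mathlib's Artin theorem)
  let ρ : ι → (↥T₀ →* ℂ) := fun i => (Units.coeHom ℂ).comp ((θ i).restrict T₀)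
  have hρ : ∀ (i : ι) (u : ↥T₀), ρ i u = ((θ i (u : T) : ℂˣ) : ℂ) := fun _ _ => rfl
  let S : Finset (↥T₀ →* ℂ) := Finset.univ.image ρ
  -- for each class `ψ` and each `m ≥ m₀`: `Σ_{ρ i = ψ} c_i θ_i(a)^m = 0` (Artin on `T₀`)
  have hclass : ∀ m : ℕ, m₀ ≤ m → ∀ ψ ∈ S, (∑ i ∈ Finset.univ.filter (fun i => ρ i = ψ), c i * ((θ i a : ℂˣ) : ℂ) ^ m) = 0 := by
    intro m hm
    -- the relation `Σ_{ψ ∈ S} g ψ • ⇑ψ = 0` on `T₀`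
    let g : (↥T₀ →* ℂ) → ℂ := fun ψ => ∑ i ∈ Finset.univ.filter (fun i => ρ i = ψ), c i * ((θ i a : ℂˣ) : ℂ) ^ m
    have hrel : ∑ ψ ∈ S, g ψ • (⇑ψ : ↥T₀ → ℂ) = 0 := by
      funext u
      rw [Finset.sum_apply, Pi.zero_apply]
      have step : ∀ ψ ∈ S, (g ψ • (⇑ψ : ↥T₀ → ℂ)) u = ∑ i ∈ Finset.univ.filter (fun i => ρ i = ψ), c i * ((θ i a : ℂˣ) : ℂ) ^ m * ρ i u := by
        intro ψ _
        rw [Pi.smul_apply, smul_eq_mul, Finset.sum_mul]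
        refine Finset.sum_congr rfl fun i hi => ?_
        rw [(Finset.mem_filter.1 hi).2]
      rw [Finset.sum_congr rfl step,
        Finset.sum_fiberwise_of_maps_to (s := Finset.univ) (t := S) (g := ρ) (fun i _ => Finset.mem_image_of_mem ρ (Finset.mem_univ i))
          (fun i => c i * ((θ i a : ℂˣ) : ℂ) ^ m * ρ i u)]
      rw [← h u u.2 m hm]
      refine Finset.sum_congr rfl fun i _ => ?_
      rw [hρ, map_mul, map_pow, Units.val_mul, Units.val_pow_eq_pow_val, mul_assoc, mul_comm (((θ i a : ℂˣ) : ℂ) ^ m)]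
    have hli := (linearIndependent_iff'.1 (linearIndependent_monoidHom (↥T₀) ℂ)) S g hrel
    exact fun ψ hψ => hli ψ hψ
  -- Vandermonde inside the class of each `i`
  funext i
  let F := {j : ι // ρ j = ρ i}
  have hz : Function.Injective (fun j : F => ((θ j.1 a : ℂˣ) : ℂ)) := by
    intro j j' hjj'
    apply Subtype.ext
    refine hθ j.1 j'.1 (fun u hu => ?_) (Units.ext hjj')
    have e := DFunLike.congr_fun (j.2.trans j'.2.symm) ⟨u, hu⟩
    exact Units.ext e
  have hz0 : ∀ j : F, ((θ j.1 a : ℂˣ) : ℂ) ≠ 0 := fun j => Units.ne_zero _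
  have hF : ∀ m : ℕ, m₀ ≤ m → ∑ j : F, c j.1 * ((θ j.1 a : ℂˣ) : ℂ) ^ m = 0 := by
    intro m hm
    rw [← hclass m hm (ρ i) (Finset.mem_image_of_mem ρ (Finset.mem_univ i))]
    exact (Finset.sum_subtype (Finset.univ.filter (fun j => ρ j = ρ i)) (fun j => by simp) (fun j => c j * ((θ j a : ℂˣ) : ℂ) ^ m)).symm
  have key := F0P3cStCharTSVandermonde.eq_zero_of_sum_mul_pow_eq_zero (fun j : F => ((θ j.1 a : ℂˣ) : ℂ)) hz hz0 (fun j : F => c j.1) m₀ hF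
  exact congrFun key ⟨i, rfl⟩

end Summit.HodgeConjecture.HodgeConjecture.Cruxes.H413.F0P3cStCharTSArtinRay

end
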